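import Summits.BirchSwinnertonDyer.BirchSwinnertonDyer.Theorems.ManinLocalTwoThreeShiftInvariantHeckeEigenvalue
import Summits.BirchSwinnertonDyer.Rank1Residual.ManinAdditive.RelativeIharaShiftVanishingEdges
import HarnessLib

/-!
# E-es-33 `HeckeDiamond` PROVED: diamond homomorphisms on `Γ₀(L)` are shift-invariant, hence `T_ℓ u_η = (ℓ + 1) u_η`;
# consequently E-es-25 `RelativeIharaShiftVanishingBar p t n` ⟸ E-es-35 `ShiftInvariantIsDiamond p t n` ALONE

Summit `BirchSwinnertonDyer`, route `ManinLocalTwoThree` (cell bsd-f2-manin), deciding crux C2 `ManinOddAtFour`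
(stmt-BirchSwinnertonDyer-22967) and crux C3 `ManinPrimeToThreeAtNine` (stmt-BirchSwinnertonDyer-22968), through the
generation stubs `stub_multiShiftClass_generation` (E-es-22) / `stub_shiftClass_generation` (E-es-19) of the active
lines `kato_shift_two` / `kato_shift_three`, which p3's `Theorems/ManinLocalTwoThreeGenerationOfRelativeIhara{,Two}.lean`
reduce to the relative Ihara leaf `Summit.BirchSwinnertonDyer.Rank1Residual.ManinAdditive.RelativeIharaShiftVanishingBar`.
The typer's `Summits/BirchSwinnertonDyer/Rank1Residual/ManinAdditive/RelativeIharaShiftVanishingEdges.lean` (es g11,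
MEMO-es §23) lands the diamond functions `diamondFun L N K η = (γ ↦ η(d_γ mod N))` and the bridge
`relativeIharaShiftVanishingBar_of_diamond_of_heckeDiamond (h1) (h2)` with TWO unproved inputs spelled out as
hypotheses: `h1` = E-es-35 `ShiftInvariantIsDiamond p t n` (shift-invariant generalised eigenclasses are Eisenstein
over `K̄` or diamond) and `h2` = E-es-33 `HeckeDiamond` (`T_ℓ u_η = (ℓ + 1) u_η` for primes `ℓ ∤ L`).

THIS FILE DISCHARGES `h2` (E-es-33) for every `N ∣ L`:
* `degeneracyPullback_diamondFun_eq` — the diamond function is SHIFT-INVARIANT at every `d` and every auxiliary level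
  (`diag(d,1) γ diag(d,1)⁻¹` has the same `d`-entry: `Gamma0.degeneracyConjElt_apply_one_one`); no hypothesis on `η`;
* `heckeU_diamondFun_eq_smul` — **E-es-33**: for a prime `ℓ ∤ L`, `T_ℓ u_η = (ℓ + 1) • u_η` EXACTLY, by p1's
  `heckeU_eq_smul_of_shiftInvariant` (`Theorems/ManinLocalTwoThreeShiftInvariantHeckeEigenvalue.lean`, the cocycle form
  of `π_{1*} π_ℓ^* = T_ℓ`, `π_{1*} π_1^* = ℓ + 1`) at the auxiliary level `L ℓ`;
* `heckeDiamond_all` — the hypothesis `h2` of the typer's bridge, VERBATIM, as a theorem;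
* `relativeIharaShiftVanishingBar_of_shiftInvariantIsDiamond (h1) : RelativeIharaShiftVanishingBar p t n` — **the leaf
  E-es-25 now rests on E-es-35 alone** (`h1` = body of es g11's `ShiftInvariantIsDiamond p t n`, verbatim as in the
  typer's bridge).

With the sibling file `Theorems/ManinLocalTwoThreeDeltaHomDiamond.lean` (E-es-34 from Vaserstein's theorem over
`ℤ[1/t]`: a `Δ_t(N)`-additive map killing the unipotents is `diamondFun` on `ι Γ₀(L)`), what remains of E-es-35 is the
cusp-symbol lift (E-es-29a, landed by p2 as `Theorems/ManinLocalTwoThreeCuspSymbolBoundary.lean`), E-es-30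
`BoundaryEisenstein`, LEMMA G, and the generalised-eigenspace glue.  Nothing here is specific to elliptic curves;
nothing about BSD or Manin's conjecture is proved by this file.

References: HOME/MEMO-es.md §23, HOME/es/Sketch-es-g11.lean §4, §8 (cell bsd-f2-manin, rows E-es-33/35);
[Shimura1971] §8.3 (8.3.2); [DiamondShurman2005] §5.2 (the `ℓ + 1` coset representatives); B. Mazur, Publ. IHÉS 47
(1977) II.16 (diamond homomorphisms).
-/

set_option autoImplicit false
set_option linter.dupNamespace false

open scoped MatrixGroups

open CongruenceSubgroup Literature.NumberTheory.EllipticCurves.ModularForms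
  Literature.NumberTheory.EllipticCurves.ModularForms.HidaCohomology
  Summit.BirchSwinnertonDyer.Rank1Residual.ManinAdditive

namespace Summit.BirchSwinnertonDyer.BirchSwinnertonDyer.Theorems.ManinLocalTwoThree

/-! ### §1  Diamond functions are shift-invariant -/

section Diamond

variable {L N : ℕ} {K : Type*} [CommRing K] (η : ZMod N → K)

/-- **The diamond function is shift-invariant at every `d` and every auxiliary level**: `π_d^* u_η = π_1^* u_η` on
`Γ₀(L')` whenever both pull-backs are defined — `diag(d,1) γ diag(d,1)⁻¹` has the same `d`-entry as `γ`.  (No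
hypothesis on `η` or `N`.) [folklore] -/
theorem degeneracyPullback_diamondFun_eq {L' d : ℕ} [NeZero d] (hd : L * d ∣ L') (h1 : L * 1 ∣ L') :
    degeneracyPullback 0 L L' d K hd (diamondFun L N K η) = degeneracyPullback 0 L L' 1 K h1 (diamondFun L N K η) := by
  funext γ i
  rw [degeneracyPullback_zero_apply, degeneracyPullback_zero_apply, Gamma0.degeneracyConj_apply,
    Gamma0.degeneracyConj_apply, diamondFun_apply, diamondFun_apply, Gamma0.degeneracyConjElt_apply_one_one,
    Gamma0.degeneracyConjElt_apply_one_one]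

/-! ### §2  E-es-33: `T_ℓ u_η = (ℓ + 1) u_η` for every prime `ℓ ∤ L` -/

/-- **E-es-33 `HeckeDiamond` (PROVED).**  For `N ∣ L`, `η` additive on the units of `ℤ/N` and a prime `ℓ ∤ L`:
`T_ℓ u_η = (ℓ + 1) • u_η` EXACTLY on `Γ₀(L)`-cochains — p1's `heckeU_eq_smul_of_shiftInvariant` at the auxiliary
level `L ℓ`, fed with the cocycle property (`diamondFun_mem_cocycles`) and shift-invariance (§1). [folklore] -/
theorem heckeU_diamondFun_eq_smul (hNL : N ∣ L) (hη : ∀ a b : ZMod N, IsUnit a → IsUnit b → η (a * b) = η a + η b)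
    {ℓ : ℕ} [NeZero ℓ] (hℓ : ℓ.Prime) (hℓL : ¬ ℓ ∣ L) :
    heckeU 0 L K hℓ (diamondFun L N K η) = ((ℓ : K) + 1) • diamondFun L N K η :=
  heckeU_eq_smul_of_shiftInvariant hℓ hℓL (L := L * ℓ) ⟨ℓ, by ring⟩ dvd_rfl dvd_rfl
    (diamondFun_mem_cocycles hNL η hη) (degeneracyPullback_diamondFun_eq η _ _)

end Diamond

/-- **The hypothesis `h2` of the typer's bridge `relativeIharaShiftVanishingBar_of_diamond_of_heckeDiamond`,
VERBATIM, as a theorem** (E-es-33 at the modulus `L / t^{v_t(L)}` for every `L`). [folklore] -/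
theorem heckeDiamond_all (t : ℕ) :
    ∀ L : ℕ, (L / t ^ (L.factorization t)) ∣ L → ∀ (K : Type) [Field K]
      (η : ZMod (L / t ^ (L.factorization t)) → K),
      (∀ a b : ZMod (L / t ^ (L.factorization t)), IsUnit a → IsUnit b → η (a * b) = η a + η b) →
      ∀ (ℓ : ℕ) [NeZero ℓ] (hℓ : ℓ.Prime), ¬ ℓ ∣ L →
        heckeU 0 L K hℓ (diamondFun L (L / t ^ (L.factorization t)) K η) =
          ((ℓ : K) + 1) • diamondFun L (L / t ^ (L.factorization t)) K η :=
  fun _ hNL _ _ η hη _ _ hℓ hℓL => heckeU_diamondFun_eq_smul η hNL hη hℓ hℓL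

/-! ### §3  E-es-25 ⟸ E-es-35 alone -/

/-- **E-es-35 ⟹ E-es-25 (the landed leaf, BY NAME).**  With E-es-33 discharged (`heckeDiamond_all`), the typer's
bridge needs only `h1` = the body of es g11's `ShiftInvariantIsDiamond p t n`: under the binders of the leaf minus the
non-Eisenstein hypothesis, a shift-invariant generalised `λ`-eigenclass is Eisenstein over `K̄` or a diamond function of
modulus `L / t^{v_t(L)}`. [folklore] -/
theorem relativeIharaShiftVanishingBar_of_shiftInvariantIsDiamond {p t n : ℕ}
    (h1 : p.Prime → t.Prime → 1 ≤ n →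
      ∀ (K : Type) [Field K] [CharP K p] (L : ℕ) [NeZero L] [NeZero t] (S : Finset ℕ)
        (lam : ℕ → K) (u : cocycles 0 L K),
        (∀ q : ℕ, q.Prime → q ∣ p * t * L → q ∈ S) →
        IsHeckeGenEigenvector S lam u →
        degeneracyPullback 0 L (L * t ^ n) (t ^ n) K dvd_rfl (u : Gamma0 L → Fin 1 → K) =
          degeneracyPullback 0 L (L * t ^ n) 1 K (by simp) (u : Gamma0 L → Fin 1 → K) →
        IsEisensteinEigensystem 2 (fun ℓ => algebraMap K (AlgebraicClosure K) (lam ℓ)) ∨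
          ∃ η : ZMod (L / t ^ (L.factorization t)) → K,
            (∀ a b : ZMod (L / t ^ (L.factorization t)), IsUnit a → IsUnit b → η (a * b) = η a + η b) ∧
            (u : Gamma0 L → Fin 1 → K) = diamondFun L (L / t ^ (L.factorization t)) K η) :
    RelativeIharaShiftVanishingBar p t n :=
  relativeIharaShiftVanishingBar_of_diamond_of_heckeDiamond h1 (heckeDiamond_all t)

/-- **Diamond ⟹ zero at any modulus `N ∣ L`** (the working form for the bottom of E-es-35: no `L / t^{v_t(L)}`
bookkeeping).  A generalised `λ`-eigenclass `u ∈ Hom(Γ₀(L), K)`, `λ` NOT Eisenstein over `K̄`, `S ⊇ primes(L)`, whose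
cochain is `diamondFun L N K η` (`η` additive on units), is `0`. [folklore] -/
theorem eq_zero_of_coe_eq_diamondFun {K : Type*} [Field K] {L N : ℕ} (hNL : N ∣ L) (S : Finset ℕ)
    (hS : ∀ q : ℕ, q.Prime → q ∣ L → q ∈ S) (lam : ℕ → K) (u : cocycles 0 L K)
    (hu : IsHeckeGenEigenvector S lam u)
    (hne : ¬ IsEisensteinEigensystem 2 (fun ℓ => algebraMap K (AlgebraicClosure K) (lam ℓ)))
    (η : ZMod N → K) (hη : ∀ a b : ZMod N, IsUnit a → IsUnit b → η (a * b) = η a + η b)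
    (hdiam : (u : Gamma0 L → Fin 1 → K) = diamondFun L N K η) : u = 0 := by
  refine eq_zero_of_heckeDiamond_of_not_eisenstein S lam u hu hne fun ℓ _ hℓ hℓS => ?_
  have hℓL : ¬ ℓ ∣ L := fun hdiv => hℓS (hS ℓ hℓ hdiv)
  refine heckeUZ_eq_smul_of_coe hℓ u _ ?_
  rw [hdiam]
  exact heckeU_diamondFun_eq_smul η hNL hη hℓ hℓL

end Summit.BirchSwinnertonDyer.BirchSwinnertonDyer.Theorems.ManinLocalTwoThree
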